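import Literature.Barriers.AnomalousDissipation.IntermittentDissipation
import Literature.Barriers.AnomalousDissipation.IntermittentDissipationSteps
import Literature.Analysis.FunctionSpaces.BesovLowerSemicontinuity
import Literature.Analysis.FunctionSpaces.BesovDifferenceProofs
import Literature.Analysis.FunctionSpaces.TorusCalculusProofs
import Literature.Analysis.FluidPDE.ClassicalOpenStripEnergy
import Literature.Analysis.FluidPDE.DuchonRobertInviscidLimit
import Literature.Analysis.FluidPDE.TorusClassicalLerayHopfProofs
import HarnessLib

/-!
# De Rosa–Isett's vanishing-viscosity intermittency theorem (Thm. 2.13) from its named inputs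

`Literature.Barriers.AnomalousDissipation.IntermittentDissipation` vendors
`DeRosaIsett2024_thm213` (De Rosa–Isett, ARMA 248 (2024), Thm. 2.13 of arXiv:2212.08176) as
a named fact; `IntermittentDissipationSteps` names the two inputs of its printed proof
(op. cit. §6.1) that are neither in Mathlib nor in the tree: `DeRosaIsett2024_thm27` (Thm. 2.7,
Eulerian intermittency for weak Euler solutions) and `DeRosaIsett2024_s61_compactness` (the
Aubin–Lions–Simon step). This file proves

* `DeRosaIsett2024_thm213_of_steps :
    DeRosaIsett2024_thm27 → DeRosaIsett2024_s61_compactness →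
      (∀ d T v, Torus.exists_pressure_of_tendsto_L3) → DeRosaIsett2024_thm213`

— the printed contradiction argument, the third hypothesis being the tree's named
Calderón–Zygmund pressure fact of `Literature.Analysis.FluidPDE.DuchonRobertInviscidLimit` —
together with everything else the argument needs (namespace `DeRosaIsett2024`, all **proved**):

* `memLpBesovSup_of_tendsto_L3` — input (3) of §6.1, "and moreover `v ∈ L^p_t(B^θ_{p,∞})`":
  the strong `L³_{t,x}` limit of fields uniformly bounded in `L^q_t B^θ_{q,∞}` inherits the
  bound (a fast subsequence converges a.e.; Fatou for the Besov difference norms is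
  `FunctionSpaces.Torus.memLpBesovSup_of_tendsto_ae` of
  `Literature.Analysis.FunctionSpaces.BesovLowerSemicontinuity`);
* `hasLocalEnergyBalance_of_inviscidLimit` — input (4) of §6.1, the identification `D^v = μ`
  of the Duchon–Robert distribution of the limit with the limiting dissipation measure
  (op. cit. §2.1; Duchon–Robert 2000, Prop. 4), modulo `Torus.exists_pressure_of_tendsto_L3`:
  the smooth `u_j` are eventually in `L³ ⊂ L²`, hence weak solutions on the open strip, the
  limit is a weak Euler solution (`isWeakEulerSolutionOn_of_inviscidLimit`), the pressures
  `p_j → P` come from the pressure fact, the energy fluxes converge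
  (`tendsto_energyFlux_of_tendsto_L3`), and the tested local energy *equality* of the smooth
  `u_j` on the open strip with the distributional pressure `p_j`
  (`IsClassicalNSSolutionOn.energyEq_of_isDistributional` of
  `Literature.Analysis.FluidPDE.ClassicalOpenStripEnergy`) identifies `E_j(ψ)` with
  `∫ ψ d(ν_j|∇u_j|² dx dt) → ∫ ψ dD`;
* `exists_test_ofMeasure_pos` — the interior zeroth law `liminf ν_j∫_δ^{T-δ}‖∇u_j‖₂² > 0`
  makes the limiting dissipation charge a smooth time cut-off `ψ` supported in `(0,T)`:
  `∫ ψ dD > 0` ("(0th_law_new) implies that at least a portion of the support of `μ` is strictly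
  inside `Ω × (0,T)`", op. cit. §2.4), the densities of the dissipation measures of smooth
  solutions being `ν_j|∇u_j|²` a.e. by uniqueness of weak gradients
  (`weakGradNormSq_ae_eq_of_isSmooth`); the cut-off is `exists_timeCutoff` (a `ContDiffBump`);
* `ofMeasure_eq_zero_of_disjoint_support` — `ψ ↦ ∫ ψ dD` vanishes on tests whose closed support
  misses `spt D` (Mathlib's `Measure.support`, conull on the second countable `ℝ × T^d`);
* `not_zeroth_of_card_le_one` — on `T⁰`, `T¹` a smooth divergence-free field has no gradient
  (`gradNormSq_eq_zero_of_card_le_one`: `∂₁v₁ = div v = 0`), so the interior zeroth law fails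
  and the target is vacuous in the dimensions `d ≤ 1` excluded by Thm. 2.7;
* the case `p = ∞`: `eLpBesovSupNorm_le_top_mul` (`‖u‖_{L^{p'}_t B^θ_{p',∞}} ≤
  |S|^{1/p'} ‖u‖_{L^∞_t B^θ_{∞,∞}}` on the probability space `T^d`, no time measurability
  needed) and `exists_finite_exponent` (the strict threshold `1 - (d-γ) < 2θ/(1-θ)` persists for
  a finite `p' ≥ 3`) reduce it to `DeRosaIsett2024_thm213_of_steps_finite`.

Once `DeRosaIsett2024_thm27`, `DeRosaIsett2024_s61_compactness` and
`Torus.exists_pressure_of_tendsto_L3` are discharged, `DeRosaIsett2024_thm213_holds` is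
`DeRosaIsett2024_thm213_of_steps` applied to their `_holds`.

## References

* L. De Rosa, P. Isett, Arch. Ration. Mech. Anal. 248 (2024), Paper No. 11; arXiv:2212.08176
  (tex source read): §2.1, §2.4 and Thm. 2.13, Thm. 2.7, §3.1, §6.1 (the proof reproduced
  here). [DeRosaIsett2024]
* J. Duchon, R. Robert, Nonlinearity 13 (2000) 249–255, Prop. 4 (input (4)). [DuchonRobert2000]
* J. Simon, Ann. Mat. Pura Appl. (4) 146 (1986/87), §8 Cor. 4 (behind
  `DeRosaIsett2024_s61_compactness`). [Simon1986]
-/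

open MeasureTheory Set Filter Topology Metric Function
open scoped ENNReal NNReal InnerProductSpace

noncomputable section

namespace Literature.Barriers.AnomalousDissipation

/-! ## Glue (proved) -/

namespace DeRosaIsett2024

open Literature.Analysis Literature.Analysis.FunctionSpaces Literature.Analysis.FluidPDE

variable {d : Type} [Fintype d] [DecidableEq d]

omit [DecidableEq d] in
/-- The functional `ψ ↦ ∫ ψ dD` of a measure vanishes on functions whose closed support misses
the support of the measure (the complement of the support is `D`-null on the second countable
`ℝ × T^d`, `Measure.measure_compl_support`). [folklore] -/
theorem ofMeasure_eq_zero_of_disjoint_support (D : Measure (ℝ × UnitAddTorus d))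
    {ψ : ℝ → UnitAddTorus d → ℝ} (hψ : Disjoint (tsupport (uncurry ψ)) D.support) :
    FluidPDE.Torus.STFunctional.ofMeasure D ψ = 0 := by
  unfold FluidPDE.Torus.STFunctional.ofMeasure
  refine integral_eq_zero_of_ae ?_
  have hae : ∀ᵐ z ∂D, z ∈ D.support := Measure.support_mem_ae
  filter_upwards [hae] with z hz
  have hz' : z ∉ tsupport (uncurry ψ) := fun h => (Set.disjoint_left.1 hψ h) hz
  simpa [uncurry] using image_eq_zero_of_notMem_tsupport hz'

omit [DecidableEq d] in
/-- **A smooth time cut-off as a space–time test function.** For `0 < δ` with `2δ < T` there is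
a smooth `η : ℝ → [0,1]`, equal to `1` on `[δ, T-δ]` and vanishing off `[δ/2, T - δ/2]`, so
that `ψ(t,x) = η(t)` is a test function supported in `(0,T)` (Mathlib's `ContDiffBump` on `ℝ`
centred at `T/2`). [folklore] -/
theorem exists_timeCutoff {T δ : ℝ} (hδ : 0 < δ) (hδT : 2 * δ < T) :
    ∃ η : ℝ → ℝ, FunctionSpaces.Torus.IsSpaceTimeTestIoo T (fun t (_ : UnitAddTorus d) => η t) ∧
      Continuous η ∧ (∀ t, 0 ≤ η t ∧ η t ≤ 1) ∧ (∀ t ∈ Icc δ (T - δ), η t = 1) ∧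
      (∀ t, η t ≠ 0 → t ∈ Icc (δ / 2) (T - δ / 2)) := by
  let f : ContDiffBump (T / 2 : ℝ) :=
    ⟨T / 2 - δ, T / 2 - δ / 2, by linarith, by linarith⟩
  have hrIn : f.rIn = T / 2 - δ := rfl
  have hrOut : f.rOut = T / 2 - δ / 2 := rfl
  have hzero : ∀ t : ℝ, t ∉ Ioo (δ / 2) (T - δ / 2) → f t = 0 := by
    intro t ht
    refine f.zero_of_le_dist ?_
    rw [Real.dist_eq, hrOut, le_abs]
    rcases not_and_or.1 (fun h => ht ⟨h.1, h.2⟩) with h | h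
    · right; linarith [not_lt.1 h]
    · left; linarith [not_lt.1 h]
  refine ⟨fun t => f t, ⟨⟨?_, T - δ / 2, by linarith, fun t ht => ?_⟩, δ / 2, by linarith,
    fun t ht => ?_⟩, f.continuous, fun t => ⟨f.nonneg, f.le_one⟩, fun t ht => ?_, fun t ht => ?_⟩
  · exact f.contDiff.comp contDiff_fst
  · funext x
    exact hzero t fun h => (not_le.2 h.2) ht
  · funext x
    exact hzero t fun h => (not_le.2 h.1) ht
  · refine f.one_of_mem_closedBall ?_
    rw [mem_closedBall, Real.dist_eq, hrIn, abs_le]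
    constructor <;> linarith [ht.1, ht.2]
  · by_contra hnot
    exact ht (hzero t fun h => hnot (Ioo_subset_Icc_self h))

/-- For a smooth field, the dissipation density of any integrable weak gradient is a.e. the
classical `∑ᵢ ‖∂ᵢv‖²` (uniqueness of integrable weak partial derivatives,
`Torus.HasWeakPartialDeriv.unique_holds`, and `Torus.IsSmooth.hasWeakPartialDeriv`). [folklore] -/
theorem weakGradNormSq_ae_eq_of_isSmooth {v : UnitAddTorus d → EuclideanSpace ℝ d}
    (hv : FunctionSpaces.Torus.IsSmooth v)
    {G : UnitAddTorus d → EuclideanSpace ℝ d →L[ℝ] EuclideanSpace ℝ d}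
    (hG : FluidPDE.Torus.HasWeakGradient v G) (hGi : Integrable G volume) :
    (fun x => FluidPDE.Torus.weakGradNormSq G x) =ᵐ[volume]
      fun x => ∑ i, ‖FunctionSpaces.Torus.partialDeriv i v x‖ ^ 2 := by
  have hi : ∀ i, (fun x => G x (EuclideanSpace.single i 1)) =ᵐ[volume]
      FunctionSpaces.Torus.partialDeriv i v := fun i =>
    FunctionSpaces.Torus.HasWeakPartialDeriv.unique_holds (EuclideanSpace ℝ d)
      (hGi.apply_continuousLinearMap _) (hv.partialDeriv i).integrable (hG i)
      (FunctionSpaces.Torus.IsSmooth.hasWeakPartialDeriv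
        FunctionSpaces.Torus.integral_partialDeriv_eq_zero_holds hv i)
  filter_upwards [ae_all_iff.2 hi] with x hx
  rw [FluidPDE.Torus.weakGradNormSq_eq_sum]
  exact Finset.sum_congr rfl fun i _ => by rw [hx i]

/-- **The interior zeroth law makes the limiting dissipation charge the open slab.** If smooth
Navier–Stokes solutions `u_j` on `T^d × (0,T)` satisfy
`liminf_j ν_j ∫_δ^{T-δ} ‖∇u_j‖₂² > 0` for some `δ > 0` and their dissipation measures converge to
`D`, then `∫ ψ dD > 0` for the time cut-off `ψ` of `exists_timeCutoff` — a test function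
supported in `(0,T)` ("the assumption (0th_law_new) implies that at least a portion of the
support of `μ` is strictly inside `Ω × (0,T)`", De Rosa–Isett 2024, §2.4; "by (0th_law_new) we
get that `D^v` is nontrivial", §6.1). The densities of the dissipation measures are
`ν_j|∇u_j|²` a.e. by `weakGradNormSq_ae_eq_of_isSmooth`. [cite: DeRosaIsett2024, §2.4 and §6.1] -/
theorem exists_test_ofMeasure_pos {T : ℝ} {ν : ℕ → ℝ} (hν : ∀ j, 0 < ν j)
    {u : ℕ → ℝ → UnitAddTorus d → EuclideanSpace ℝ d} {p : ℕ → ℝ → UnitAddTorus d → ℝ}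
    (hNS : ∀ j, FunctionSpaces.Torus.IsClassicalNSSolutionOn (Ioo 0 T) (ν j) 0 (u j) (p j))
    (hzeroth : ∃ δ : ℝ, 0 < δ ∧
      0 < liminf (fun j => ENNReal.ofReal
        (FunctionSpaces.Torus.cumulativeDissipation (ν j) (u j) δ (T - δ))) atTop)
    {D : Measure (ℝ × UnitAddTorus d)} (hD : FluidPDE.Torus.IsDissipationMeasureOf ν u T D) :
    ∃ ψ : ℝ → UnitAddTorus d → ℝ, FunctionSpaces.Torus.IsSpaceTimeTestIoo T ψ ∧
      0 < FluidPDE.Torus.STFunctional.ofMeasure D ψ := by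
  obtain ⟨δ, hδ, hlim⟩ := hzeroth
  -- the interval `[δ, T - δ]` is non-degenerate
  have hδT : 2 * δ < T := by
    by_contra h
    have h0 : ∀ j, ENNReal.ofReal
        (FunctionSpaces.Torus.cumulativeDissipation (ν j) (u j) δ (T - δ)) = 0 := by
      intro j
      rw [ENNReal.ofReal_eq_zero, FunctionSpaces.Torus.cumulativeDissipation,
        intervalIntegral.integral_symm]
      exact mul_nonpos_iff.2 (Or.inl ⟨(hν j).le, neg_nonpos.2 (intervalIntegral.integral_nonneg
        (by linarith) fun t _ => FunctionSpaces.Torus.gradNormSq_nonneg _)⟩)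
    simp [h0] at hlim
  obtain ⟨η, hη, hηc, hη01, hη1, hηsupp⟩ := exists_timeCutoff (d := d) hδ hδT
  refine ⟨fun t _ => η t, hη, ?_⟩
  obtain ⟨G, hGm, hGae, hGfin, -, hGlim⟩ := hD
  have hlimψ := hGlim hη.toBCF
  simp only [FunctionSpaces.Torus.IsSpaceTimeTestIoo.toBCF_apply] at hlimψ
  -- lower bound: `ν_j ∫_δ^{T-δ} ‖∇u_j‖² ≤ ∫ η d(ν_j |∇u_j|² dx dt)`
  have hlow : ∀ j, FunctionSpaces.Torus.cumulativeDissipation (ν j) (u j) δ (T - δ) ≤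
      ∫ z, η z.1 ∂(FluidPDE.Torus.dissipationMeasure (ν j) (G j) T) := by
    intro j
    set g : ℝ → ℝ := fun t => FunctionSpaces.Torus.gradNormSq (u j t) with hg
    set F : ℝ → ℝ := fun t => ν j * g t * η t with hF
    have hψm : AEStronglyMeasurable (uncurry fun (t : ℝ) (_ : UnitAddTorus d) => η t)
        ((volume.restrict (Ioo 0 T)).prod volume) :=
      (hηc.comp continuous_fst).aestronglyMeasurable
    have hψb : ∃ C : ℝ, ∀ (t : ℝ) (_x : UnitAddTorus d), |η t| ≤ C :=
      ⟨1, fun t _ => abs_le.2 ⟨by linarith [(hη01 t).1], (hη01 t).2⟩⟩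
    have hpair := FluidPDE.Torus.integral_dissipationMeasure_eq (ψ := fun t _ => η t) (hν j)
      (hGm j) (hGfin j) hψm hψb
    rw [hpair]
    -- the inner integrals, for a.e. `t ∈ (0,T)`
    have hinner : ∀ᵐ t ∂(volume.restrict (Ioo 0 T)),
        (∫ x, ν j * FluidPDE.Torus.weakGradNormSq (G j t) x * η t) = F t := by
      filter_upwards [hGae j, ae_restrict_mem measurableSet_Ioo] with t ht htI
      have hsm : FunctionSpaces.Torus.IsSmooth (u j t) :=
        (hNS j).smooth_velocity.isSmooth_slice htI
      rw [integral_mul_const, integral_const_mul, hF, hg]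
      simp only
      rw [integral_congr_ae (weakGradNormSq_ae_eq_of_isSmooth hsm ht.1 ht.2)]
      rfl
    rw [integral_congr_ae hinner]
    -- `F` is continuous on `(0,T)`, vanishes off `[δ/2, T-δ/2]`, and equals `ν_j g` on `[δ,T-δ]`
    have hgc : ContinuousOn g (Ioo 0 T) :=
      (hNS j).smooth_velocity.continuousOn_gradNormSq (convex_Ioo 0 T) (uniqueDiffOn_Ioo 0 T)
    have hK : Icc (δ / 2) (T - δ / 2) ⊆ Ioo 0 T := fun t ht => ⟨by linarith [ht.1], by linarith [ht.2]⟩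
    have hFc : ContinuousOn F (Icc (δ / 2) (T - δ / 2)) :=
      ((continuousOn_const.mul (hgc.mono hK)).mul hηc.continuousOn)
    have hFi : IntegrableOn F (Ioo 0 T) volume := by
      refine (hFc.integrableOn_compact isCompact_Icc).of_forall_sdiff_eq_zero measurableSet_Ioo ?_
      intro t ht
      have : η t = 0 := by
        by_contra hne
        exact ht.2 (hηsupp t hne)
      simp [hF, this]
    have hF0 : 0 ≤ᵐ[volume.restrict (Ioo 0 T)] F :=
      Eventually.of_forall fun t => mul_nonneg (mul_nonneg (hν j).le
        (FunctionSpaces.Torus.gradNormSq_nonneg _)) (hη01 t).1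
    have hδδ : δ ≤ T - δ := by linarith
    calc FunctionSpaces.Torus.cumulativeDissipation (ν j) (u j) δ (T - δ)
        = ∫ t in Ioc δ (T - δ), ν j * g t := by
          rw [FunctionSpaces.Torus.cumulativeDissipation, intervalIntegral.integral_of_le hδδ,
            integral_const_mul]
      _ = ∫ t in Ioc δ (T - δ), F t := by
          refine setIntegral_congr_fun measurableSet_Ioc fun t ht => ?_
          simp [hF, hη1 t ⟨ht.1.le, ht.2⟩]
      _ ≤ ∫ t in Ioo 0 T, F t :=
          setIntegral_mono_set hFi hF0 (Eventually.of_forall fun t ht =>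
            ⟨by linarith [ht.1], by linarith [ht.2]⟩)
  -- pass to the limit
  have h1 : Tendsto (fun m => ENNReal.ofReal (∫ z, η z.1 ∂(FluidPDE.Torus.dissipationMeasure (ν m) (G m) T)))
      atTop (𝓝 (ENNReal.ofReal (∫ z, η z.1 ∂D))) :=
    (ENNReal.continuous_ofReal.tendsto _).comp hlimψ
  have h2 : liminf (fun j => ENNReal.ofReal
      (FunctionSpaces.Torus.cumulativeDissipation (ν j) (u j) δ (T - δ))) atTop ≤
      ENNReal.ofReal (∫ z, η z.1 ∂D) := by
    rw [← h1.liminf_eq]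
    exact liminf_le_liminf (Eventually.of_forall fun j => ENNReal.ofReal_le_ofReal (hlow j))
  exact ENNReal.ofReal_pos.1 (hlim.trans_le h2)

/-- Cumulative dissipation over a reversed (or degenerate) time interval is nonpositive
(`∫_a^b = -∫_b^a` and the integrand `‖∇u‖₂² ≥ 0`). [folklore] -/
theorem cumulativeDissipation_nonpos_of_le {ν : ℝ} (hν : 0 ≤ ν)
    (u : ℝ → UnitAddTorus d → EuclideanSpace ℝ d) {a b : ℝ} (hba : b ≤ a) :
    FunctionSpaces.Torus.cumulativeDissipation ν u a b ≤ 0 := by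
  rw [FunctionSpaces.Torus.cumulativeDissipation, intervalIntegral.integral_symm]
  exact mul_nonpos_iff.2 (Or.inl ⟨hν, neg_nonpos.2 (intervalIntegral.integral_nonneg hba
    fun t _ => FunctionSpaces.Torus.gradNormSq_nonneg _)⟩)

/-- Components commute with partial derivatives: `(∂ᵢv)_k = ∂ᵢ(v_k)` for `C¹` fields (chain rule
with the coordinate projection). [folklore] -/
theorem partialDeriv_apply_coord {v : UnitAddTorus d → EuclideanSpace ℝ d}
    (hv : FunctionSpaces.Torus.IsContDiff 1 v) (i k : d) (x : UnitAddTorus d) :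
    FunctionSpaces.Torus.partialDeriv i v x k = FunctionSpaces.Torus.partialDeriv i (fun y => v y k) x := by
  have hvk : FunctionSpaces.Torus.IsContDiff 1 (fun y => v y k) :=
    (EuclideanSpace.proj k : EuclideanSpace ℝ d →L[ℝ] ℝ).contDiff.comp hv
  have hd : DifferentiableAt ℝ (FunctionSpaces.Torus.liftAt v x) 0 :=
    ((hv.liftAt x).differentiable one_ne_zero).differentiableAt
  have hcomp : FunctionSpaces.Torus.fderiv (fun y => v y k) x =
      (EuclideanSpace.proj k : EuclideanSpace ℝ d →L[ℝ] ℝ).comp (FunctionSpaces.Torus.fderiv v x) := by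
    have h : FunctionSpaces.Torus.liftAt (fun y => v y k) x =
        (EuclideanSpace.proj k : EuclideanSpace ℝ d →L[ℝ] ℝ) ∘ FunctionSpaces.Torus.liftAt v x := by
      funext w; rfl
    rw [FunctionSpaces.Torus.fderiv, FunctionSpaces.Torus.fderiv, h]
    exact ((EuclideanSpace.proj k).hasFDerivAt.comp (0 : EuclideanSpace ℝ d) hd.hasFDerivAt).fderiv
  rw [FunctionSpaces.Torus.partialDeriv_eq_fderiv_apply hv,
    FunctionSpaces.Torus.partialDeriv_eq_fderiv_apply hvk, hcomp]
  rfl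

/-- **No gradient in dimension `≤ 1`.** On `T⁰` and `T¹` a smooth divergence-free field has
`‖∇v‖₂² = 0`: there is at most one coordinate, and `∂₁v₁ = div v = 0`. [folklore] -/
theorem gradNormSq_eq_zero_of_card_le_one (hd : Fintype.card d ≤ 1)
    {v : UnitAddTorus d → EuclideanSpace ℝ d} (hv : FunctionSpaces.Torus.IsSmooth v)
    (hdiv : FunctionSpaces.Torus.IsDivFree v) : FunctionSpaces.Torus.gradNormSq v = 0 := by
  have hpt : ∀ x, (∑ i, ‖FunctionSpaces.Torus.partialDeriv i v x‖ ^ 2) = 0 := by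
    intro x
    rcases Nat.le_one_iff_eq_zero_or_eq_one.1 hd with h0 | h1
    · haveI : IsEmpty d := Fintype.card_eq_zero_iff.1 h0
      simp [Finset.univ_eq_empty]
    · obtain ⟨i₀, hi₀⟩ := Fintype.card_eq_one_iff.1 h1
      have hv1 : FunctionSpaces.Torus.IsContDiff 1 v := hv.isContDiff (by simp)
      have hpd : FunctionSpaces.Torus.partialDeriv i₀ v x = 0 := by
        refine PiLp.ext fun k => ?_
        obtain rfl := hi₀ k
        rw [partialDeriv_apply_coord hv1]
        have hdx := hdiv x
        rw [FunctionSpaces.Torus.divergence, Fintype.sum_eq_single k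
          (fun j hj => (hj (hi₀ j)).elim)] at hdx
        simpa using hdx
      rw [Fintype.sum_eq_single i₀ (fun j hj => (hj (hi₀ j)).elim), hpd, norm_zero]
      norm_num
  unfold FunctionSpaces.Torus.gradNormSq
  simp [hpt]

/-- **The interior zeroth law fails in dimension `≤ 1`**: for smooth divergence-free families on
`T⁰`/`T¹` every cumulative dissipation over `[δ, T-δ] ⊂ (0,T)` vanishes (and is nonpositive when
the interval degenerates), so `liminf_j ν_j ∫_δ^{T-δ} ‖∇u_j‖₂² = 0`. [folklore] -/
theorem not_zeroth_of_card_le_one (hd : Fintype.card d ≤ 1) {T : ℝ} {ν : ℕ → ℝ}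
    (hν : ∀ j, 0 < ν j) {u : ℕ → ℝ → UnitAddTorus d → EuclideanSpace ℝ d}
    {p : ℕ → ℝ → UnitAddTorus d → ℝ}
    (hNS : ∀ j, FunctionSpaces.Torus.IsClassicalNSSolutionOn (Ioo 0 T) (ν j) 0 (u j) (p j)) :
    ¬ ∃ δ : ℝ, 0 < δ ∧ 0 < liminf (fun j => ENNReal.ofReal
        (FunctionSpaces.Torus.cumulativeDissipation (ν j) (u j) δ (T - δ))) atTop := by
  rintro ⟨δ, hδ, hlim⟩
  have h0 : ∀ j, ENNReal.ofReal
      (FunctionSpaces.Torus.cumulativeDissipation (ν j) (u j) δ (T - δ)) = 0 := by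
    intro j
    rw [ENNReal.ofReal_eq_zero]
    rcases le_or_gt (T - δ) δ with hle | hlt
    · exact cumulativeDissipation_nonpos_of_le (hν j).le (u j) hle
    · refine le_of_eq ?_
      rw [FunctionSpaces.Torus.cumulativeDissipation, intervalIntegral.integral_congr
        (g := fun _ => (0 : ℝ)) fun t ht => ?_, intervalIntegral.integral_zero, mul_zero]
      rw [uIcc_of_le hlt.le] at ht
      have htI : t ∈ Ioo 0 T := ⟨hδ.trans_le ht.1, by linarith [ht.2]⟩
      exact gradNormSq_eq_zero_of_card_le_one hd ((hNS j).smooth_velocity.isSmooth_slice htI)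
        ((hNS j).divFree t htI)
  simp [h0] at hlim

omit [DecidableEq d] in
/-- On the probability space `T^d`, `L^q` norms are dominated by the `L^∞` norm (no
measurability needed: `eLpNorm'_le_eLpNormEssSup`). [folklore] -/
theorem eLpNorm_le_eLpNorm_top {F : Type*} [NormedAddCommGroup F] (g : UnitAddTorus d → F)
    (q : ℝ≥0∞) : eLpNorm g q volume ≤ eLpNorm g ∞ volume := by
  rcases eq_or_ne q 0 with rfl | hq0
  · simp
  rcases eq_or_ne q ∞ with rfl | hqtop
  · exact le_rfl
  rw [eLpNorm_eq_eLpNorm' hq0 hqtop, eLpNorm_exponent_top]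
  exact eLpNorm'_le_eLpNormEssSup (ENNReal.toReal_pos hq0 hqtop)

omit [DecidableEq d] in
/-- On `T^d`, the Besov norm `‖·‖_{B^θ_{q,∞}}` is dominated by `‖·‖_{B^θ_{∞,∞}}` (termwise, by
`eLpNorm_le_eLpNorm_top`). [folklore] -/
theorem eBesovSupNorm_le_top {F : Type*} [NormedAddCommGroup F] (g : UnitAddTorus d → F)
    (θ : ℝ) (q : ℝ≥0∞) :
    FunctionSpaces.eBesovSupNorm θ q g volume ≤ FunctionSpaces.eBesovSupNorm θ ∞ g volume := by
  unfold FunctionSpaces.eBesovSupNorm FunctionSpaces.eBesovSupSeminorm FunctionSpaces.eDiffQuotient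
  exact add_le_add (eLpNorm_le_eLpNorm_top g q)
    (iSup₂_mono fun h _ => ENNReal.div_le_div_right (eLpNorm_le_eLpNorm_top _ q) _)

omit [DecidableEq d] in
/-- **`L^q_t B^θ_{q,∞}` is dominated by `L^∞_t B^θ_{∞,∞}` on bounded time sets**:
`‖u‖_{L^q(S; B^θ_{q,∞})} ≤ |S|^{1/q} ‖u‖_{L^∞(S; B^θ_{∞,∞})}` for `0 < q < ∞`, provided the
slices in `S` have finite `B^θ_{∞,∞}` norm (so that the real-valued time integrands compare;
`eLpNorm'_le_eLpNormEssSup_mul_rpow_measure_univ`, no time measurability needed). [folklore] -/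
theorem eLpBesovSupNorm_le_top_mul {F : Type*} [NormedAddCommGroup F] (u : ℝ → UnitAddTorus d → F)
    {S : Set ℝ} (hS : MeasurableSet S) (θ : ℝ)
    (hu : ∀ t ∈ S, FunctionSpaces.eBesovSupNorm θ ∞ (u t) volume ≠ ∞)
    {q : ℝ≥0∞} (hq0 : q ≠ 0) (hqtop : q ≠ ∞) :
    FunctionSpaces.eLpBesovSupNorm q θ q u volume S ≤
      FunctionSpaces.eLpBesovSupNorm ∞ θ ∞ u volume S * volume S ^ (1 / q.toReal) := by
  unfold FunctionSpaces.eLpBesovSupNorm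
  have hmono : ∀ᵐ t ∂(volume.restrict S),
      ‖(FunctionSpaces.eBesovSupNorm θ q (u t) volume).toReal‖ ≤
        ‖(FunctionSpaces.eBesovSupNorm θ ∞ (u t) volume).toReal‖ := by
    filter_upwards [ae_restrict_mem hS] with t ht
    rw [Real.norm_of_nonneg ENNReal.toReal_nonneg, Real.norm_of_nonneg ENNReal.toReal_nonneg]
    exact ENNReal.toReal_mono (hu t ht) (eBesovSupNorm_le_top _ _ _)
  refine (eLpNorm_mono_ae hmono).trans ?_
  rw [eLpNorm_eq_eLpNorm' hq0 hqtop, eLpNorm_exponent_top]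
  refine (eLpNorm'_le_eLpNormEssSup_mul_rpow_measure_univ (ENNReal.toReal_pos hq0 hqtop)).trans_eq ?_
  rw [Measure.restrict_apply_univ]

/-- The threshold inequality of Thm. 2.13 at `p = ∞`, `1 - (d-γ) < 2θ/(1-θ)`, persists for
some finite exponent `p' ≥ 3`: `1 - (1 - 3/p')(d-γ) < 2θ/(1-θ)` (the left side tends to
`1 - (d-γ)` as `p' → ∞`; Archimedes). [folklore] -/
theorem exists_finite_exponent {n γ A : ℝ}
    (h : 1 - (1 - 3 / (∞ : ℝ≥0∞)).toReal * (n - γ) < A) :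
    ∃ N : ℕ, 3 ≤ N ∧ 1 - (1 - 3 / (N : ℝ≥0∞)).toReal * (n - γ) < A := by
  have h' : 1 - (n - γ) < A := by simpa using h
  set ε : ℝ := A - (1 - (n - γ)) with hε
  have hεpos : 0 < ε := by linarith
  obtain ⟨N₀, hN₀⟩ := exists_nat_gt (3 * (n - γ) / ε)
  refine ⟨max 3 N₀, le_max_left _ _, ?_⟩
  set N : ℕ := max 3 N₀ with hN
  have hN3 : (3 : ℝ) ≤ N := by exact_mod_cast le_max_left 3 N₀
  have hNpos : (0 : ℝ) < N := by linarith
  have hN₀le : (N₀ : ℝ) ≤ N := by exact_mod_cast le_max_right 3 N₀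
  have htoReal : (1 - 3 / (N : ℝ≥0∞)).toReal = 1 - 3 / (N : ℝ) := by
    have hle : (3 : ℝ≥0∞) / N ≤ 1 := by
      rw [ENNReal.div_le_iff (by exact_mod_cast (show (N : ℕ) ≠ 0 by omega))
        (ENNReal.natCast_ne_top N), one_mul]
      exact_mod_cast (le_max_left 3 N₀)
    rw [ENNReal.toReal_sub_of_le hle ENNReal.one_ne_top, ENNReal.toReal_one, ENNReal.toReal_div,
      ENNReal.toReal_natCast]
    norm_num
  rw [htoReal]
  have hkey : 3 * (n - γ) / N < ε := by
    rw [div_lt_iff₀ hNpos]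
    calc 3 * (n - γ) = 3 * (n - γ) / ε * ε := by field_simp
      _ < N₀ * ε := by gcongr
      _ ≤ N * ε := by gcongr
      _ = ε * N := mul_comm _ _
  have hexp : 1 - (1 - 3 / (N : ℝ)) * (n - γ) = 1 - (n - γ) + 3 * (n - γ) / N := by ring
  rw [hexp]
  linarith

end DeRosaIsett2024


/-! ## From strong `L³_{t,x}` convergence to the Besov bound of the limit (proved) -/

namespace DeRosaIsett2024

open Literature.Analysis Literature.Analysis.FunctionSpaces Literature.Analysis.FluidPDE

variable {d : Type} [Fintype d] [DecidableEq d]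

omit [DecidableEq d] in
/-- **Lower semicontinuity of the `L^q_t B^θ_{q,∞}` norm under strong `L³_{t,x}`
convergence** (folklore Fatou; the step "`v^ν → v` in `L^p_{x,t}` and moreover
`v ∈ L^p_t(B^θ_{p,∞})`" of De Rosa–Isett 2024, §6.1): the `L³((0,T) × T^d)` limit `v` of
jointly measurable fields `w_k` with slices in `B^θ_{q,∞}(T^d)` for a.e. `t` and
`‖w_k‖_{L^q(0,T;B^θ_{q,∞})} ≤ M` (`1 ≤ q < ∞`) has `v(t) ∈ B^θ_{q,∞}` for a.e. `t` and
`‖v‖_{L^q(0,T;B^θ_{q,∞})} ≤ M`. A fast subsequence converges a.e. on `(0,T) × T^d`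
(`Torus.exists_subseq_tendsto_ae_of_tendsto_lintegral`, Tonelli), and the a.e. form is the
tree's `FunctionSpaces.Torus.memLpBesovSup_of_tendsto_ae` (`BesovLowerSemicontinuity`). [folklore] -/
theorem memLpBesovSup_of_tendsto_L3 {E : Type*} [NormedAddCommGroup E] {T : ℝ}
    {w : ℕ → ℝ → UnitAddTorus d → E} {v : ℝ → UnitAddTorus d → E}
    {q : ℝ≥0∞} (hq : 1 ≤ q) (hq' : q ≠ ∞) {θ : ℝ} {M : ℝ≥0}
    (hw : ∀ k, AEStronglyMeasurable (FunctionSpaces.Torus.stLift (w k))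
      (volume.restrict (Ioo 0 T ×ˢ univ)))
    (hwB : ∀ k, FunctionSpaces.MemLpBesovSup q θ q (w k) volume (Ioo 0 T))
    (hwM : ∀ k, FunctionSpaces.eLpBesovSupNorm q θ q (w k) volume (Ioo 0 T) ≤ M)
    (hv : AEStronglyMeasurable (FunctionSpaces.Torus.stLift v) (volume.restrict (Ioo 0 T ×ˢ univ)))
    (hconv : Tendsto (fun k => ∫⁻ t in Ioo 0 T, ∫⁻ x, ‖w k t x - v t x‖ₑ ^ (3 : ℕ))
      atTop (𝓝 0)) :
    FunctionSpaces.MemLpBesovSup q θ q v volume (Ioo 0 T) ∧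
      FunctionSpaces.eLpBesovSupNorm q θ q v volume (Ioo 0 T) ≤ M := by
  set μT := (volume.restrict (Ioo 0 T)).prod (volume : Measure (UnitAddTorus d)) with hμT
  have hwm' : ∀ k, AEStronglyMeasurable (uncurry (w k)) μT := fun k =>
    FluidPDE.Torus.aestronglyMeasurable_uncurry_prod (hw k)
  have hvm' : AEStronglyMeasurable (uncurry v) μT :=
    FluidPDE.Torus.aestronglyMeasurable_uncurry_prod hv
  -- a.e. convergence on `(0,T) × T^d` along a fast subsequence
  set g : ℕ → ℝ × UnitAddTorus d → ℝ≥0∞ := fun k z => ‖w k z.1 z.2 - v z.1 z.2‖ₑ ^ (3 : ℕ) with hg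
  have hgm : ∀ k, AEMeasurable (g k) μT := fun k => ((hwm' k).sub hvm').enorm.pow_const 3
  have hgconv : Tendsto (fun k => ∫⁻ z, g k z ∂μT) atTop (𝓝 0) := by
    refine hconv.congr fun k => ?_
    exact FluidPDE.Torus.lintegral_Ioo_lintegral_eq_lintegral_prod
      (g := fun t x => ‖w k t x - v t x‖ₑ ^ (3 : ℕ)) (hgm k)
  obtain ⟨φ, -, hae⟩ := FluidPDE.Torus.exists_subseq_tendsto_ae_of_tendsto_lintegral hgm hgconv
  have hae' : ∀ᵐ z ∂μT, Tendsto (fun k => w (φ k) z.1 z.2) atTop (𝓝 (v z.1 z.2)) := by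
    filter_upwards [hae] with z hz
    rw [tendsto_iff_edist_tendsto_0]
    have h3 : Tendsto (fun k => (g (φ k) z) ^ ((3 : ℝ)⁻¹)) atTop (𝓝 0) := by
      have := ((ENNReal.continuous_rpow_const (y := (3 : ℝ)⁻¹)).tendsto 0).comp hz
      rwa [ENNReal.zero_rpow_of_pos (by norm_num)] at this
    refine h3.congr fun k => ?_
    simp only [hg, edist_eq_enorm_sub]
    rw [← ENNReal.rpow_natCast, ← ENNReal.rpow_mul]
    norm_num
  exact FunctionSpaces.Torus.memLpBesovSup_of_tendsto_ae hq hq' (fun k => hwm' (φ k))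
    (fun k => hwB (φ k)) (fun k => hwM (φ k)) hvm' hae'

end DeRosaIsett2024

/-! ## The identification `D^v = μ` along smooth vanishing-viscosity families (proved, modulo the
Calderón–Zygmund pressure fact of `DuchonRobertInviscidLimit`) -/

namespace DeRosaIsett2024

open Literature.Analysis Literature.Analysis.FunctionSpaces Literature.Analysis.FluidPDE

variable {d : Type} [Fintype d] [DecidableEq d]

/-- **Vanishing-viscosity limits of smooth solutions dissipate through the Duchon–Robert
distribution: `D^v = μ`** (De Rosa–Isett 2024, §2.1: "`lim_{ν→0} ν|∇v^ν|² = D^v` in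
`𝒟'(Ω × (0,T))`, as soon as `v^ν → v` in `L³_{x,t}`", used in §6.1; Duchon–Robert 2000,
Prop. 4), assembled from the tree: granted the Calderón–Zygmund pressure fact
`Torus.exists_pressure_of_tendsto_L3` (for this limit field `v`), if smooth Navier–Stokes
solutions `u_j` on the open strip `T^d × (0,T)` with `ν_j > 0`, `ν_j → 0` converge to `v` in
`L³((0,T) × T^d)` (`v ∈ L³` jointly measurable) and `D` is a dissipation measure of the family,
then there is an `L^{3/2}` pressure `P` with `(v, P)` a distributional Euler solution and
`∫∫ [½|v|²∂ₜψ + (½|v|² + P)⟪v,∇ψ⟫] = ∫ ψ dD` for all tests supported in `(0,T)`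
(`Torus.HasLocalEnergyBalance T 0 v P 0 (STFunctional.ofMeasure D)`). Proof: the `u_j` are
eventually in `L³ ⊂ L²`, hence weak solutions on the open strip
(`IsClassicalNSSolutionOn.isWeakNSSolutionOn_of_Ioo`); `v` is a weak Euler solution
(`isWeakEulerSolutionOn_of_inviscidLimit`); the pressure fact supplies distributional pressures
`p_j → P` in `L^{3/2}`; the tested local energy *equality* of the smooth `u_j` with the
pressure `p_j` (`IsClassicalNSSolutionOn.energyEq_of_isDistributional`) identifies the energy
flux `E_j(ψ)` with `∫ ψ d(ν_j|∇u_j|² dx dt)` (densities by `weakGradNormSq_ae_eq_of_isSmooth`),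
which tends to `∫ ψ dD`, while `E_j(ψ) → E(ψ)` (`tendsto_energyFlux_of_tendsto_L3`). [cite: DeRosaIsett2024, §2.1 and §6.1] [cite: DuchonRobert2000, Prop. 4] -/
theorem hasLocalEnergyBalance_of_inviscidLimit {T : ℝ} {ν : ℕ → ℝ}
    {u : ℕ → ℝ → UnitAddTorus d → EuclideanSpace ℝ d} {p : ℕ → ℝ → UnitAddTorus d → ℝ}
    {v : ℝ → UnitAddTorus d → EuclideanSpace ℝ d} {D : Measure (ℝ × UnitAddTorus d)}
    (hA1 : FluidPDE.Torus.exists_pressure_of_tendsto_L3 (T := T) (u := v))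
    (hν : ∀ j, 0 < ν j) (hν₀ : Tendsto ν atTop (𝓝 0))
    (hNS : ∀ j, FunctionSpaces.Torus.IsClassicalNSSolutionOn (Ioo 0 T) (ν j) 0 (u j) (p j))
    (hD : FluidPDE.Torus.IsDissipationMeasureOf ν u T D)
    (hvm : AEStronglyMeasurable (FunctionSpaces.Torus.stLift v) (volume.restrict (Ioo 0 T ×ˢ univ)))
    (hv3 : ∫⁻ t in Ioo 0 T, ∫⁻ x, ‖v t x‖ₑ ^ (3 : ℕ) < ∞)
    (hconv : Tendsto (fun j => ∫⁻ t in Ioo 0 T, ∫⁻ x, ‖u j t x - v t x‖ₑ ^ (3 : ℕ)) atTop (𝓝 0)) :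
    ∃ P : ℝ → UnitAddTorus d → ℝ,
      FluidPDE.Torus.IsDistributionalNSSolutionOn T 0 0 v P ∧
      (∫⁻ t in Ioo 0 T, ∫⁻ x, ‖P t x‖ₑ ^ (3 / 2 : ℝ) < ∞) ∧
      FluidPDE.Torus.HasLocalEnergyBalance T 0 v P 0 (FluidPDE.Torus.STFunctional.ofMeasure D) := by
  set μT := (volume.restrict (Ioo 0 T)).prod (volume : Measure (UnitAddTorus d)) with hμT
  have hum : ∀ j, AEStronglyMeasurable (FunctionSpaces.Torus.stLift (u j))
      (volume.restrict (Ioo 0 T ×ˢ univ)) := fun j =>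
    (hNS j).smooth_velocity.aestronglyMeasurable_stLift measurableSet_Ioo Subset.rfl
  have hum' : ∀ j, AEStronglyMeasurable (uncurry (u j)) μT := fun j =>
    FluidPDE.Torus.aestronglyMeasurable_uncurry_prod (hum j)
  have hvm' : AEStronglyMeasurable (uncurry v) μT := FluidPDE.Torus.aestronglyMeasurable_uncurry_prod hvm
  -- the `u_j` are eventually in `L³ ⊂ L²`, hence weak solutions on the open strip
  have hu3 : ∀ᶠ j in atTop, ∫⁻ t in Ioo 0 T, ∫⁻ x, ‖u j t x‖ₑ ^ (3 : ℕ) < ∞ :=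
    FluidPDE.Torus.eventually_lintegral_enorm_pow_three_lt_top (Eventually.of_forall hum') hvm' hconv hv3
  have hfinT : ENNReal.ofReal T ^ (1 / 3 : ℝ) ≠ ∞ :=
    ENNReal.rpow_ne_top_of_nonneg (by norm_num) ENNReal.ofReal_ne_top
  have hW : ∀ᶠ j in atTop, FunctionSpaces.Torus.IsWeakNSSolutionOn T (ν j) (u j) := by
    filter_upwards [hu3] with j hj
    refine (hNS j).isWeakNSSolutionOn_of_Ioo (lt_of_le_of_lt (FluidPDE.Torus.lintegral_enorm_sq_le (hum' j)) ?_)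
    exact ENNReal.mul_lt_top hfinT.lt_top (ENNReal.rpow_lt_top_of_nonneg (by norm_num) hj.ne)
  -- the limit is a weak Euler solution
  have hL2 : Tendsto (fun j => ∫⁻ t in Ioo 0 T, ∫⁻ x, ‖u j t x - v t x‖ₑ ^ 2) atTop (𝓝 0) :=
    FluidPDE.Torus.tendsto_lintegral_enorm_sq (Eventually.of_forall fun j => (hum' j).sub hvm') hconv
  have hv2 : ∫⁻ t in Ioo 0 T, ∫⁻ x, ‖v t x‖ₑ ^ 2 < ∞ :=
    lt_of_le_of_lt (FluidPDE.Torus.lintegral_enorm_sq_le hvm')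
      (ENNReal.mul_lt_top hfinT.lt_top (ENNReal.rpow_lt_top_of_nonneg (by norm_num) hv3.ne))
  have hE : FunctionSpaces.Torus.IsWeakEulerSolutionOn T v :=
    FluidPDE.Torus.isWeakEulerSolutionOn_of_inviscidLimit hν₀ hW hvm hv2 hL2
  -- the pressures
  obtain ⟨pseq, P, hpev, hdist, hP32, hpconv⟩ := hA1 hW hE hconv hv3
  refine ⟨P, hdist, hP32, fun h0 => absurd rfl h0, fun ψ hψ => ?_⟩
  -- the energy fluxes converge
  have hflux := FluidPDE.Torus.tendsto_energyFlux_of_tendsto_L3 hν₀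
    (hpev.mono fun j hj => ⟨hum j, hj.1.2.2.1⟩) hvm hdist.2.2.1 hconv hv3 hpconv hP32 hψ
  -- the dissipation side
  obtain ⟨G, hGm, hGae, hGfin, -, hGlim⟩ := hD
  have hlimD := hGlim hψ.toBCF
  simp only [FunctionSpaces.Torus.IsSpaceTimeTestIoo.toBCF_apply] at hlimD
  have hψm : AEStronglyMeasurable (uncurry ψ) μT :=
    (hψ.isSpaceTimeTest.isSmoothSpaceTimeOn_derived.1.bound_and_measurable T).2
  obtain ⟨Cψ, hCψ⟩ := hψ.exists_abs_le
  -- eventually, the energy flux of `u_j` (with pressure `pseq j`) is `∫ ψ d(ν_j |∇u_j|²)`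
  have hkey : ∀ᶠ j in atTop, ∫ t in Ioo 0 T, ∫ x,
      (2⁻¹ * ‖u j t x‖ ^ 2 * FunctionSpaces.Torus.timeDeriv ψ t x +
        (2⁻¹ * ‖u j t x‖ ^ 2 + pseq j t x) * ⟪u j t x, FunctionSpaces.Torus.gradient (ψ t) x⟫_ℝ +
        2⁻¹ * ν j * ‖u j t x‖ ^ 2 * FunctionSpaces.Torus.laplacian (ψ t) x) =
      ∫ z, ψ z.1 z.2 ∂(FluidPDE.Torus.dissipationMeasure (ν j) (G j) T) := by
    filter_upwards [hpev] with j hj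
    rw [(hNS j).energyEq_of_isDistributional hj.1 hψ,
      FluidPDE.Torus.integral_dissipationMeasure_eq (hν j) (hGm j) (hGfin j) hψm ⟨Cψ, hCψ⟩,
      ← integral_const_mul]
    refine integral_congr_ae ?_
    filter_upwards [hGae j, ae_restrict_mem measurableSet_Ioo] with t ht htI
    have hsm : FunctionSpaces.Torus.IsSmooth (u j t) := (hNS j).smooth_velocity.isSmooth_slice htI
    rw [← integral_const_mul]
    refine integral_congr_ae ?_
    filter_upwards [weakGradNormSq_ae_eq_of_isSmooth hsm ht.1 ht.2] with x hx
    rw [hx]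
    ring
  have hlim1 := hlimD.congr' (EventuallyEq.symm hkey)
  have hEq := tendsto_nhds_unique hflux hlim1
  -- the balance at `ν = 0`
  show _ = ∫ z, ψ z.1 z.2 ∂D
  rw [← hEq]
  refine integral_congr_ae (ae_of_all _ fun t => integral_congr_ae (ae_of_all _ fun x => ?_))
  simp only [mul_zero, zero_mul, add_zero, sub_zero]

end DeRosaIsett2024

/-! ## Assembly: Thm. 2.13 from the named inputs -/

section Assembly

open Literature.Analysis Literature.Analysis.FunctionSpaces Literature.Analysis.FluidPDE
open DeRosaIsett2024

/-- **Thm. 2.13 for finite exponents `p ∈ [3,∞)` and `d ≥ 2`**, from the named inputs (the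
printed contradiction argument of De Rosa–Isett 2024, §6.1): if the `L^q_t B^θ_{q,∞}` norms do
not tend to `∞`, a subsequence is bounded by some `M`; by `DeRosaIsett2024_s61_compactness` a
further subsequence converges in `L³_{t,x}` to `v`, which lies in `L^q_t B^θ_{q,∞}` by
`memLpBesovSup_of_tendsto_L3`; by `hasLocalEnergyBalance_of_inviscidLimit` (applied to the
subsequence, whose dissipation measures still converge to `D`; it consumes the Calderón–Zygmund
pressure fact `Torus.exists_pressure_of_tendsto_L3`) the local energy defect of `(v, P)` is
`D`, which is supported in `spt D`; `DeRosaIsett2024_thm27` then forces `∫ ψ dD = 0` for all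
tests, contradicting the interior zeroth law (`exists_test_ofMeasure_pos`). [cite: DeRosaIsett2024, Thm. 2.13 and §6.1] -/
theorem DeRosaIsett2024_thm213_of_steps_finite (h27 : DeRosaIsett2024_thm27)
    (hc : DeRosaIsett2024_s61_compactness)
    (hA1 : ∀ {d : Type} [Fintype d] {T : ℝ} {v : ℝ → UnitAddTorus d → EuclideanSpace ℝ d},
      FluidPDE.Torus.exists_pressure_of_tendsto_L3 (d := d) (T := T) (u := v))
    {d : Type} [Fintype d] [DecidableEq d] (hd : 2 ≤ Fintype.card d) {T : ℝ} (hT : 0 < T)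
    {ν : ℕ → ℝ} (hν : ∀ j, 0 < ν j) (hν₀ : Tendsto ν atTop (𝓝 0))
    {u : ℕ → ℝ → UnitAddTorus d → EuclideanSpace ℝ d} {p : ℕ → ℝ → UnitAddTorus d → ℝ}
    (hNS : ∀ j, FunctionSpaces.Torus.IsClassicalNSSolutionOn (Ioo 0 T) (ν j) 0 (u j) (p j))
    (hzeroth : ∃ δ : ℝ, 0 < δ ∧
      0 < liminf (fun j => ENNReal.ofReal
        (FunctionSpaces.Torus.cumulativeDissipation (ν j) (u j) δ (T - δ))) atTop)
    {D : Measure (ℝ × UnitAddTorus d)} (hD : FluidPDE.Torus.IsDissipationMeasureOf ν u T D)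
    {γ : ℝ} (hγ : 0 ≤ γ ∧ γ ≤ Fintype.card d)
    (hdim : ∃ C : ℝ≥0∞, C ≠ ∞ ∧ ∃ δ₀ : ℝ, 0 < δ₀ ∧ ∀ δ ∈ Ioo 0 δ₀,
      volume (thickening δ D.support) ≤ C * ENNReal.ofReal (δ ^ ((Fintype.card d : ℝ) - γ)))
    {q : ℝ≥0∞} (hq : 3 ≤ q) (hq' : q ≠ ∞) {θ : ℝ} (hθ : 0 < θ ∧ θ < 1)
    (hcond : 1 - (1 - 3 / q).toReal * ((Fintype.card d : ℝ) - γ) < 2 * θ / (1 - θ)) :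
    Tendsto (fun j => FunctionSpaces.eLpBesovSupNorm q θ q (u j) volume (Ioo 0 T)) atTop (𝓝 ∞) := by
  -- the limiting dissipation charges a test function (original sequence)
  obtain ⟨ψ₀, hψ₀, hpos⟩ := exists_test_ofMeasure_pos hν hNS hzeroth hD
  by_contra hnot
  rw [ENNReal.tendsto_nhds_top_iff_nnreal] at hnot
  push Not at hnot
  obtain ⟨M, hfreq⟩ := hnot
  obtain ⟨φ₁, hφ₁, hbound⟩ := extraction_of_frequently_atTop hfreq
  -- compactness along the bounded subsequence
  obtain ⟨φ₂, v, hφ₂, hvm, hv3, hconv⟩ := hc d T hT (fun j => ν (φ₁ j)) (fun j => hν (φ₁ j))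
    (hν₀.comp hφ₁.tendsto_atTop) (fun j => u (φ₁ j)) (fun j => p (φ₁ j)) (fun j => hNS (φ₁ j))
    q hq hq' θ hθ M (fun j => hbound j)
  set φ : ℕ → ℕ := fun k => φ₁ (φ₂ k) with hφdef
  have hφ : StrictMono φ := hφ₁.comp hφ₂
  -- the limit inherits the Besov bound
  have hwB : ∀ k, FunctionSpaces.MemLpBesovSup q θ q (u (φ k)) volume (Ioo 0 T) := fun k => by
    refine ⟨(ae_restrict_iff' measurableSet_Ioo).2 (ae_of_all _ fun t ht => ?_), ?_⟩
    · exact FunctionSpaces.Torus.IsSmooth.memBesovSup_holds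
        ((hNS (φ k)).smooth_velocity.isSmooth_slice ht) hθ.2.le q
    · exact (hbound (φ₂ k)).trans_lt ENNReal.coe_lt_top
  have hwm : ∀ k, AEStronglyMeasurable (FunctionSpaces.Torus.stLift (u (φ k)))
      (volume.restrict (Ioo 0 T ×ˢ univ)) := fun k =>
    (hNS (φ k)).smooth_velocity.aestronglyMeasurable_stLift measurableSet_Ioo Subset.rfl
  obtain ⟨hvB, -⟩ := memLpBesovSup_of_tendsto_L3 (le_trans (by norm_num) hq) hq' hwm hwB
    (fun k => hbound (φ₂ k)) hvm hconv
  -- identification of the defect along the subsequence (dissipation measures pass to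
  -- subsequences: `DeRosaDrivasInversiIsett2025.isDissipationMeasureOf_subseq` of
  -- `IntermittentDissipation`)
  have hDφ : FluidPDE.Torus.IsDissipationMeasureOf (fun k => ν (φ k)) (fun k => u (φ k)) T D :=
    DeRosaDrivasInversiIsett2025.isDissipationMeasureOf_subseq hD hφ
  obtain ⟨P, hsol, hP32, hbal⟩ := hasLocalEnergyBalance_of_inviscidLimit hA1
    (fun k => hν (φ k)) (hν₀.comp hφ.tendsto_atTop) (fun k => hNS (φ k)) hDφ hvm hv3 hconv
  -- `D` is supported in its support
  have hDS : ∀ ψ : ℝ → UnitAddTorus d → ℝ, FunctionSpaces.Torus.IsSpaceTimeTestIoo T ψ →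
      Disjoint (tsupport (uncurry ψ)) D.support →
        FluidPDE.Torus.STFunctional.ofMeasure D ψ = 0 :=
    fun ψ _ hdisj => ofMeasure_eq_zero_of_disjoint_support D hdisj
  -- Thm. 2.7 kills the defect: contradiction
  have hzero := h27 d hd T hT v P hsol hP32 q hq hq' θ hθ hvB
    (FluidPDE.Torus.STFunctional.ofMeasure D) hbal D.support Measure.isClosed_support hDS γ hγ
    hdim hcond ψ₀ hψ₀
  exact (ne_of_gt hpos) hzero

/-- **De Rosa–Isett's Thm. 2.13 from its named inputs** (Thm. 2.7 `DeRosaIsett2024_thm27`,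
the Aubin–Lions–Simon step `DeRosaIsett2024_s61_compactness`, and the tree's Calderón–Zygmund
pressure fact `Torus.exists_pressure_of_tendsto_L3`; lower semicontinuity of the Besov norms
and the identification `D^v = μ` are the proved `DeRosaIsett2024.memLpBesovSup_of_tendsto_L3`
and `DeRosaIsett2024.hasLocalEnergyBalance_of_inviscidLimit`): the cases
`card d ≤ 1` are vacuous (`not_zeroth_of_card_le_one`), finite exponents are
`DeRosaIsett2024_thm213_of_steps_finite`, and `p = ∞` is reduced to a large finite exponent
(`exists_finite_exponent`, `eLpBesovSupNorm_le_top_mul`). Once the named inputs are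
discharged, `DeRosaIsett2024_thm213_holds` is this theorem applied to their `_holds`. [cite: DeRosaIsett2024, Thm. 2.13 and §6.1] -/
theorem DeRosaIsett2024_thm213_of_steps (h27 : DeRosaIsett2024_thm27)
    (hc : DeRosaIsett2024_s61_compactness)
    (hA1 : ∀ {d : Type} [Fintype d] {T : ℝ} {v : ℝ → UnitAddTorus d → EuclideanSpace ℝ d},
      FluidPDE.Torus.exists_pressure_of_tendsto_L3 (d := d) (T := T) (u := v)) :
    DeRosaIsett2024_thm213 := by
  intro d _ _ T hT ν hν hν₀ u p hNS hzeroth D hD γ hγ hdim q hq θ hθ hcond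
  -- low dimensions are vacuous
  rcases lt_or_ge (Fintype.card d) 2 with hd | hd
  · exact absurd hzeroth (not_zeroth_of_card_le_one (by omega) hν hNS)
  rcases eq_or_ne q ∞ with rfl | hq'
  · -- `p = ∞`: reduce to a large finite exponent
    obtain ⟨N, hN3, hcondN⟩ := exists_finite_exponent hcond
    have hN3' : (3 : ℝ≥0∞) ≤ N := by exact_mod_cast hN3
    have hfin := DeRosaIsett2024_thm213_of_steps_finite h27 hc hA1 hd hT hν hν₀ hNS hzeroth
      hD hγ hdim hN3' (ENNReal.natCast_ne_top N) hθ hcondN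
    -- compare the two norms
    set C : ℝ≥0∞ := volume (Ioo 0 T) ^ (1 / (N : ℝ≥0∞).toReal) with hC
    have hCtop : C ≠ ∞ := by
      refine ENNReal.rpow_ne_top_of_nonneg (by positivity) ?_
      rw [Real.volume_Ioo]; exact ENNReal.ofReal_ne_top
    have hN0 : (N : ℝ≥0∞) ≠ 0 := by exact_mod_cast (show N ≠ 0 by omega)
    have hle : ∀ j, FunctionSpaces.eLpBesovSupNorm N θ N (u j) volume (Ioo 0 T) ≤
        FunctionSpaces.eLpBesovSupNorm ∞ θ ∞ (u j) volume (Ioo 0 T) * C := fun j =>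
      eLpBesovSupNorm_le_top_mul (u j) measurableSet_Ioo θ (fun t ht => by
        have hmem := FunctionSpaces.Torus.IsSmooth.memBesovSup_holds
          ((hNS j).smooth_velocity.isSmooth_slice ht) hθ.2.le ∞
        unfold FunctionSpaces.eBesovSupNorm
        exact ENNReal.add_ne_top.2 ⟨hmem.1.eLpNorm_ne_top, hmem.2.ne⟩) hN0 (ENNReal.natCast_ne_top N)
    have hdiv : Tendsto (fun j => FunctionSpaces.eLpBesovSupNorm N θ N (u j) volume (Ioo 0 T) / C)
        atTop (𝓝 ∞) := by
      have := ENNReal.Tendsto.div_const hfin (Or.inl ENNReal.top_ne_zero) (b := C)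
      rwa [ENNReal.top_div_of_ne_top hCtop] at this
    exact tendsto_nhds_top_mono hdiv (Eventually.of_forall fun j =>
      ENNReal.div_le_of_le_mul (hle j))
  · exact DeRosaIsett2024_thm213_of_steps_finite h27 hc hA1 hd hT hν hν₀ hNS hzeroth hD hγ
      hdim hq hq' hθ hcond

end Assembly


end Literature.Barriers.AnomalousDissipation

end
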